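import Mathlib
import Literature.NumberTheory.Automorphic.ResGLnCohomology
import HarnessLib

/-!
# `GL_n(K)⁺` has finite index in `GL_n(K)` (stub `stub_glTotPos_finiteIndex` of line `Sketch`)

Crux `HeckeEigenvalueField` (stmt-Langlands-13632). For a number field `K`, the subgroup
`GL_n(K)⁺ = ResGLnCohomology.glTotPos n K` of `g ∈ GL_n(K)` with `τ(det g) > 0` at every real
embedding `τ : K →+* ℝ` has finite index in `GL_n(K)`: it is the (finite, as `K →+* ℝ` is finite)
intersection over `τ` of the preimages under `g ↦ τ(g)` of `GL_n(ℝ)⁺ = det⁻¹(ℝˣ_{>0})`, and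
`ℝˣ_{>0}` has index `2` in `ℝˣ`; preimages and finite intersections of finite-index subgroups have
finite index. (In fact `[GL_n(K) : GL_n(K)⁺] ≤ 2^{r_1}`, with equality for `n ≥ 1` by weak
approximation; only finiteness is used downstream, through Shapiro's lemma over the finitely many
`GL_n(K)⁺`-orbits on `GL_n(𝔸_K^∞)/K_f(𝔫)`.) [folklore]
-/

set_option linter.dupNamespace false -- project-wide: Summit.Langlands.Langlands is the mandated namespace

noncomputable section

open Literature.NumberTheory.Automorphic ResGLnCohomology

namespace Summit.Langlands.Langlands.Theorems.HeckeEigenvalueField.Res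

/-- The positive units `ℝˣ_{>0}` have index `2` in `ℝˣ`: for every unit `b` exactly one of `b`,
`b * (-1) = -b` is positive. [folklore] -/
private theorem index_posSubgroup_real : (Units.posSubgroup ℝ).index = 2 := by
  refine Subgroup.index_eq_two_iff.mpr ⟨-1, fun b => ?_⟩
  simp only [Units.mem_posSubgroup, mul_neg, mul_one, Units.val_neg, Left.neg_pos_iff]
  rcases lt_or_gt_of_ne b.ne_zero with h | h
  · exact Or.inl ⟨h, not_lt.mpr h.le⟩
  · exact Or.inr ⟨h, not_lt.mpr h.le⟩

/-- `ℝˣ_{>0}` has finite index (namely `2`) in `ℝˣ`. [folklore] -/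
private theorem finiteIndex_posSubgroup_real : (Units.posSubgroup ℝ).FiniteIndex :=
  ⟨by rw [index_posSubgroup_real]; exact two_ne_zero⟩

/-- The preimage of a finite-index subgroup under a group homomorphism has finite index
(`[G' : f⁻¹ H] = [f(G') : H ∩ f(G')] ≤ [G : H]`). [folklore] -/
private theorem finiteIndex_comap {G G' : Type*} [Group G] [Group G'] (H : Subgroup G)
    [H.FiniteIndex] (f : G' →* G) : (H.comap f).FiniteIndex :=
  ⟨by
    rw [Subgroup.index_comap]
    haveI : H.IsFiniteRelIndex f.range := Subgroup.isFiniteRelIndex_of_finiteIndex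
    exact Subgroup.relIndex_ne_zero⟩

/-- `GL_n(ℝ)⁺ = {g ∈ GL_n(ℝ) | 0 < det g}` (Mathlib's `Matrix.GLPos (Fin n) ℝ`, the preimage of
`ℝˣ_{>0}` under `det`) has finite index in `GL_n(ℝ)`. [folklore] -/
private theorem finiteIndex_glPos_real (n : ℕ) : (Matrix.GLPos (Fin n) ℝ).FiniteIndex := by
  haveI : (Units.posSubgroup ℝ).FiniteIndex := finiteIndex_posSubgroup_real
  unfold Matrix.GLPos
  exact finiteIndex_comap (Units.posSubgroup ℝ) Matrix.GeneralLinearGroup.det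

/-- **Stub 1** — `GL_n(K)⁺ = glTotPos n K` has finite index in `GL_n(K)` for a number field `K`:
`glTotPos n K = ⨅_{τ : K →+* ℝ} τ⁻¹(GL_n(ℝ)⁺)` is a finite intersection (a number field has
finitely many real embeddings) of preimages of the finite-index subgroup `GL_n(ℝ)⁺ ≤ GL_n(ℝ)`.
[folklore] -/
theorem stub_glTotPos_finiteIndex :
    ∀ (n : ℕ) (K : Type) [Field K] [NumberField K], (glTotPos n K).FiniteIndex := by
  intro n K _ _
  haveI : (Matrix.GLPos (Fin n) ℝ).FiniteIndex := finiteIndex_glPos_real n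
  unfold glTotPos
  exact Subgroup.finiteIndex_iInf fun τ =>
    finiteIndex_comap (Matrix.GLPos (Fin n) ℝ) (Matrix.GeneralLinearGroup.map τ)

end Summit.Langlands.Langlands.Theorems.HeckeEigenvalueField.Res

end
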